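import Summits.AtomisticToContinuum.Crystallization.Theorems.ChargedEnergyGapScaleSummability
import Summits.AtomisticToContinuum.Crystallization.Theorems.ChargedEnergyGapAffineChargingA
import HarnessLib

/-!
# Charged energy gap — lens-3 g67, «HcpAffineStabilityBox»: STAB-h in census form and the CLASS-LEVEL [A-i]ʰ glue

Cell `decomp-a2c`, seat lens-3, generation 67, part P-N⁗·g (APPEND over «ScaleSummability» `…Theorems.ChargedEnergyGapScaleSummability`; same namespace; also imports
the tree's `…Theorems.ChargedEnergyGapAffineChargingA` for `summable_bondQuad_affineField`).  ELEMENTARY·PROVED; complete (no placeholders); standard axioms.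

WHAT IT DOES (the hcp twin of «AffineStabilityFccClass»/«FccScaleNumerics»: class-level sitewise affine stability [A-i]ʰ from TWO census certificates).
* §N6 `quadTermAff a h s m i₀ j₀ A t := bondQuad (affineField A) (barlowPos m i₀ j₀) (barlowPos t)` — the `ℤ³` family of the affine-probe quadratic site
  term; ★ `quadSite_affineField_barlow_eq_tsum`: for a periodic configuration whose point set IS `barlowStacking a h s`, `quadSite (affineField A) P ∅ (barlowPos m i₀ j₀)
  = ¼·Σ'_t quadTermAff … t` (`quadSite_empty_eq` + `tsum_barlowStacking_punctured`); `summable_quadTermAff_of_periodic` (genuine sums for periodic words, from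
  the tree's `summable_bondQuad_affineField` with the operator-norm bound, transported through `barlowPos`) with the instances `Hcp.summable_quadTermAff_alt`,
  `Fcc.summable_quadTermAff_const`; `points_eq_image_add_of_mem_lattice` (a period presents the point set as its own translate).
* ★ `Hcp.HcpAffineStabilityBox a₁ a₂ h₁ h₂ κ` · UNDECIDED · TRUE-leaning · CERT-able — STAB-h IN CENSUS FORM on the (U-h) box: for `ε = ±1`, `(a, h)` in the box,
  base site `m ∈ {0, 1}`, every probe `A` and unit `u`: `κ⟪u, A u⟫² ≤ ¼·Σ'_t quadTermAff a h (ε·alternatingHagg) m 0 0 A t` (template for the certificate: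
  «AffineStabilityFcc» §S1–§S3 — second moments of a finite neighbour shell + `sq_biform_le` — run with interval coefficients over the box).
* ★★ `Hcp.sitewiseAffineStability_hcpClass_of_box`: `HcpScaleBox a₁ a₂ h₁ h₂ → HcpAffineStabilityBox a₁ a₂ h₁ h₂ κ →` for EVERY site-stress-free periodic
  presentation `P` of an isometric image of an hcp-class stacking (Hägg word, alternating letters, window) and EVERY `y ∈ P.points`:
  `∀ A u, ‖u‖ = 1 → κ⟪u, A u⟫² ≤ quadSite (affineField A) P ∅ y`.  Proof: `(a, h)` in the box («HcpScaleBox»); rigid presentation `x ↦ L x + c` of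
  `P₀ := barlowPeriodicConfiguration (ε·alternatingHagg)` (period 2; motif = the two base sites); `y = L (barlowPos n 0 0 + g₀) + c` with `n ∈ {0,1}`, `g₀` a period;
  the certificate at the base site, transported along the period and along the rigid motion (`Fcc.sitewiseAffineStability_transport`, twice).
So the hcp side of [A-i] on the (R4) record path is reduced to the two census statements `HcpScaleBox` + `HcpAffineStabilityBox` on ONE box, exactly as the
fcc side is reduced to `FccScaleNumerics` (+ the landed [A-i]@fccRef, κ = 3/8).
-/

open scoped Classical
open Literature.MathematicalPhysics.StatisticalMechanics Literature.Geometry.DiscreteGeometry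
open Summit.AtomisticToContinuum.Crystallization.Theses.PricedLinkCensus
open Summit.AtomisticToContinuum.Crystallization.Theorems.ChargedEnergyGapNegative

namespace Summit.AtomisticToContinuum.Crystallization.Theorems.ChargedEnergyGapChartDial

variable {P : PeriodicConfiguration 3}

/-! ## §N6 The affine-probe quadratic site term of a Barlow stacking as a `ℤ³` sum; STAB-h in census form; class-level [A-i]ʰ ⟸ two certificates -/

section AffineProbe

/-- THE `ℤ³` FAMILY of the affine-probe quadratic site term of `barlowStacking a h s` at the site `barlowPos m i₀ j₀`:
`t ↦ bondQuad (affineField A) y (barlowPos t)` = `V″(d)⟪ê, A p⟫² + (V′(d)/d)(‖A p‖² − ⟪ê, A p⟫²)`, `p = barlowPos t − y`, `d = ‖p‖`, `ê = p/d`. -/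
noncomputable def quadTermAff (a h : ℝ) (s : ℤ → ℤ) (m i₀ j₀ : ℤ) (A : E3 →ₗ[ℝ] E3) (t : ℤ × ℤ × ℤ) : ℝ :=
  bondQuad (affineField A) (barlowPos a h s m i₀ j₀) (barlowPos a h s t.1 t.2.1 t.2.2)

/-- The degenerate bond `y → y` carries no affine-probe energy. -/
theorem bondQuad_affineField_self (A : E3 →ₗ[ℝ] E3) (y : E3) : bondQuad (affineField A) y y = 0 := by
  simp [bondQuad]

/-- ★ The affine-probe quadratic site term of a periodic configuration WHOSE POINT SET IS a Barlow stacking, at a lattice site, IS `¼` of the `ℤ³` sum of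
`quadTermAff` (`quadSite_empty_eq` + `ℤ³` re-indexing `tsum_barlowStacking_punctured`). -/
theorem quadSite_affineField_barlow_eq_tsum {a h : ℝ} {s : ℤ → ℤ} (ha : 0 < a) (hh : 0 < h) (hP : P.points = barlowStacking a h s)
    (m i₀ j₀ : ℤ) (A : E3 →ₗ[ℝ] E3) :
    quadSite (affineField A) P ∅ (barlowPos a h s m i₀ j₀) = (1 / 4) * ∑' t : ℤ × ℤ × ℤ, quadTermAff a h s m i₀ j₀ A t := by
  rw [quadSite_empty_eq]
  congr 1
  set y := barlowPos a h s m i₀ j₀ with hy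
  let e : {z : E3 // z ∈ P.points ∧ z ≠ y} ≃ {w : E3 // w ∈ barlowStacking a h s ∧ w ≠ y} :=
    Equiv.subtypeEquivRight fun z => by rw [hP]
  rw [← e.symm.tsum_eq]
  exact tsum_barlowStacking_punctured ha hh s m i₀ j₀ (fun w => bondQuad (affineField A) y w) (bondQuad_affineField_self A y)

/-- A period of a periodic configuration presents its point set as its own translate. -/
theorem points_eq_image_add_of_mem_lattice (Q : PeriodicConfiguration 3) {g : E3} (hg : g ∈ Q.lattice) :
    Q.points = (fun x => (LinearIsometryEquiv.refl ℝ E3) x + g) '' Q.points := by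
  ext z
  simp only [LinearIsometryEquiv.coe_refl, id_eq, Set.mem_image]
  constructor
  · intro hz
    exact ⟨z - g, (add_mem_points_iff Q hg (z - g)).1 (by rwa [sub_add_cancel]), sub_add_cancel z g⟩
  · rintro ⟨x, hx, rfl⟩
    exact Q.add_mem_points hx hg

/-- The `ℤ³` affine-probe family is summable for every PERIODIC word (so the certificate's sum is a genuine sum): the tree's `summable_bondQuad_affineField`
(bond terms of an affine probe summable over the punctured point set of any periodic configuration; the needed bound `‖A x‖ ≤ ‖A‖·‖x‖` is the operator norm
of the finite-dimensional map) on `barlowPeriodicConfiguration s …`, transported to `ℤ³` through the injective parametrisation `barlowPos`. -/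
theorem summable_quadTermAff_of_periodic {a h : ℝ} (ha : 0 < a) (hh : 0 < h) {s : ℤ → ℤ} {p : ℕ} (hp : p ≠ 0) (hs : ∀ i, s (i + p) = s i)
    (m i₀ j₀ : ℤ) (A : E3 →ₗ[ℝ] E3) : Summable (quadTermAff a h s m i₀ j₀ A) := by
  set y := barlowPos a h s m i₀ j₀ with hy
  set P₀ := barlowPeriodicConfiguration s ha.ne' hh.ne' hp hs with hP₀
  have hpts : P₀.points = barlowStacking a h s := barlowPeriodicConfiguration_points s ha.ne' hh.ne' hp hs
  set F : E3 → ℝ := fun w => bondQuad (affineField A) y w with hF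
  have hA : ∀ x, ‖A x‖ ≤ ‖LinearMap.toContinuousLinearMap A‖ * ‖x‖ := fun x => (LinearMap.toContinuousLinearMap A).le_opNorm x
  have hS0 : Summable fun z : {z : E3 // z ∈ P₀.points ∧ z ≠ y} => F z := summable_bondQuad_affineField P₀ A y hA
  let e : {z : E3 // z ∈ P₀.points ∧ z ≠ y} ≃ {w : E3 // w ∈ barlowStacking a h s ∧ w ≠ y} :=
    Equiv.subtypeEquivRight fun z => by rw [hpts]
  have hS : Summable fun w : {w : E3 // w ∈ barlowStacking a h s ∧ w ≠ y} => F w :=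
    (e.summable_iff (f := fun w : {w : E3 // w ∈ barlowStacking a h s ∧ w ≠ y} => F w)).1 hS0
  have h1 : Summable ({w : E3 | w ∈ barlowStacking a h s ∧ w ≠ y}.indicator F) :=
    (summable_subtype_iff_indicator (s := {w : E3 | w ∈ barlowStacking a h s ∧ w ≠ y})).1 hS
  refine (h1.comp_injective (barlowPos_injective ha hh s)).congr fun t => ?_
  simp only [Function.comp, quadTermAff]
  by_cases ht : barlowPos a h s t.1 t.2.1 t.2.2 = y
  · rw [ht, Set.indicator_of_notMem (by simp)]
    exact (bondQuad_affineField_self A y).symm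
  · exact Set.indicator_of_mem (show barlowPos a h s t.1 t.2.1 t.2.2 ∈ {w : E3 | w ∈ barlowStacking a h s ∧ w ≠ y} from
      ⟨barlowPos_mem t.1 t.2.1 t.2.2, ht⟩) F

/-- hcp class: the certificate's sums are genuine sums (period 2), every `ε`, every site, every probe. -/
theorem Hcp.summable_quadTermAff_alt {a h : ℝ} (ha : 0 < a) (hh : 0 < h) (ε m i₀ j₀ : ℤ) (A : E3 →ₗ[ℝ] E3) :
    Summable (quadTermAff a h (fun i => ε * alternatingHagg i) m i₀ j₀ A) :=
  summable_quadTermAff_of_periodic ha hh two_ne_zero (smul_alternatingHagg_periodic ε) m i₀ j₀ A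

/-- fcc: likewise (period 1). -/
theorem Fcc.summable_quadTermAff_const {a h : ℝ} (ha : 0 < a) (hh : 0 < h) (m i₀ j₀ : ℤ) (A : E3 →ₗ[ℝ] E3) :
    Summable (quadTermAff a h constHagg m i₀ j₀ A) :=
  summable_quadTermAff_of_periodic ha hh one_ne_zero (fun _ => rfl) m i₀ j₀ A

end AffineProbe

namespace Hcp

/-- ★ piece STAB-h-box · UNDECIDED · TRUE-leaning · CERT-able · **THE hcp AFFINE STABILITY CERTIFICATE IN CENSUS FORM** (parameters: the (U-h) box
`[a₁, a₂] × [h₁, h₂]` and the constant `κ`): for `ε ∈ {1, −1}`, `(a, h)` in the box and the two base sites `m ∈ {0, 1}` (`A`- and `B`-layer), the explicit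
`ℤ³` quadratic form `¼·Σ'_t quadTermAff a h (ε·alternatingHagg) m 0 0 A t` in the probe `A` dominates `κ·⟪u, A u⟫²` for every unit `u` (floats at the hcp
point, memo g61/g66: margins like the fcc `3/8`; interval certificate over the box outstanding).  Why it might fail: a soft shear direction of the strained hcp
family inside the box (none numerically; the box is `10⁻³`-small around a strict local minimum). -/
def HcpAffineStabilityBox (a₁ a₂ h₁ h₂ κ : ℝ) : Prop :=
  ∀ (ε : ℤ) (a h : ℝ), (ε = 1 ∨ ε = -1) → a₁ ≤ a → a ≤ a₂ → h₁ ≤ h → h ≤ h₂ → ∀ m : ℤ, (m = 0 ∨ m = 1) →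
    ∀ (A : E3 →ₗ[ℝ] E3) (u : E3), ‖u‖ = 1 →
      κ * inner ℝ u (A u) ^ 2 ≤ (1 / 4) * ∑' t : ℤ × ℤ × ℤ, quadTermAff a h (fun i => ε * alternatingHagg i) m 0 0 A t

/-- ★★ **CLASS-LEVEL [A-i]ʰ FROM THE TWO hcp CERTIFICATES**: given `HcpScaleBox a₁ a₂ h₁ h₂` ((U-h)-box) and `HcpAffineStabilityBox a₁ a₂ h₁ h₂ κ`
(STAB-h on that box), EVERY site-stress-free periodic presentation of an isometric image of an hcp-class Barlow stacking (Hägg word with alternating letters,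
window) satisfies the sitewise affine stability inequality with constant `κ` at EVERY point.  Proof: `(a, h)` is in the box (`hcpClass_scale_mem_box`); rigid
presentation `x ↦ L x + c` of `P₀ := barlowPeriodicConfiguration (ε·alternatingHagg)` (period 2, motif = the two base sites); a point of `P` is
`L (barlowPos n 0 0 + g₀) + c`, `n ∈ {0, 1}`, `g₀` a period; stability at the base site (`quadSite_affineField_barlow_eq_tsum` + the certificate), transported
along the period (`points_eq_image_add_of_mem_lattice`) and along the rigid motion (`Fcc.sitewiseAffineStability_transport`, twice). -/
theorem sitewiseAffineStability_hcpClass_of_box {a₁ a₂ h₁ h₂ κ : ℝ} (hN : HcpScaleBox a₁ a₂ h₁ h₂) (hQ : HcpAffineStabilityBox a₁ a₂ h₁ h₂ κ)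
    (P : PeriodicConfiguration 3) {a h : ℝ} {s : ℤ → ℤ} {g : E3 → E3}
    (ha : 9 / 10 ≤ a ∧ a ≤ 11 / 10) (hh : 0 < h ∧ 27 / 50 * a ^ 2 ≤ h ^ 2 ∧ h ^ 2 ≤ 121 / 150 * a ^ 2) (hH : IsHaggSeq s) (hs : ∀ i, s (i + 1) = -s i)
    (hg : Isometry g) (hP : P.points = g '' barlowStacking a h s) (hS : IsSiteStressFree P) :
    ∀ y ∈ P.points, ∀ (A : E3 →ₗ[ℝ] E3) (u : E3), ‖u‖ = 1 → κ * inner ℝ u (A u) ^ 2 ≤ quadSite (affineField A) P ∅ y := by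
  obtain ⟨hb₁, hb₂, hb₃, hb₄⟩ := hcpClass_scale_mem_box hN P ha hh hH hs hg hP hS
  obtain ⟨L, c, hLc⟩ := Fcc.exists_linearIsometryEquiv_of_isometry hg
  have ha0 : 0 < a := by linarith [ha.1]
  have hg' : g = fun x => L x + c := funext hLc
  have hw : s = fun i => s 0 * alternatingHagg i := word_eq_smul_alternating hs
  set s' : ℤ → ℤ := fun i => s 0 * alternatingHagg i with hs'
  let P₀ : PeriodicConfiguration 3 := barlowPeriodicConfiguration s' ha0.ne' hh.1.ne' two_ne_zero (smul_alternatingHagg_periodic (s 0))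
  have hP₀ : P₀.points = barlowStacking a h s' := barlowPeriodicConfiguration_points s' ha0.ne' hh.1.ne' two_ne_zero _
  have hPP₀ : P.points = (fun x => L x + c) '' P₀.points := by rw [hP₀, hP, hg', ← hw]
  have hX : (∅ : Set E3) = (fun x => L x + c) '' ∅ := by simp
  intro y hy A u hu
  rw [hPP₀] at hy
  obtain ⟨w, hw₀, rfl⟩ := hy
  obtain ⟨q, hq, g₀, hg₀, rfl⟩ := hw₀
  obtain ⟨n, hn, rfl⟩ := Finset.mem_image.1 hq
  have hn2 : (n : ℤ) = 0 ∨ (n : ℤ) = 1 := by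
    have := Finset.mem_range.1 hn
    omega
  -- stability at the base site `barlowPos n 0 0` of `P₀`, from the certificate
  have h0 : ∀ (A : E3 →ₗ[ℝ] E3) (u : E3), ‖u‖ = 1 → κ * inner ℝ u (A u) ^ 2 ≤ quadSite (affineField A) P₀ ∅ (barlowPos a h s' (n : ℤ) 0 0) := by
    intro A' u' hu'
    rw [quadSite_affineField_barlow_eq_tsum ha0 hh.1 hP₀ (n : ℤ) 0 0 A']
    exact hQ (s 0) a h (hH 0) hb₁ hb₂ hb₃ hb₄ (n : ℤ) hn2 A' u' hu'
  -- along the period `g₀`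
  have h1 := Fcc.sitewiseAffineStability_transport (LinearIsometryEquiv.refl ℝ E3) g₀ (P := P₀) (P' := P₀) (X := ∅) (X' := ∅)
    (points_eq_image_add_of_mem_lattice P₀ hg₀) (by simp) (barlowPos a h s' (n : ℤ) 0 0) κ h0
  simp only [LinearIsometryEquiv.coe_refl, id_eq] at h1
  -- along the rigid motion
  exact Fcc.sitewiseAffineStability_transport L c (P := P₀) (P' := P) hPP₀ hX (barlowPos a h s' (n : ℤ) 0 0 + g₀) κ h1 A u hu

end Hcp

end Summit.AtomisticToContinuum.Crystallization.Theorems.ChargedEnergyGapChartDial
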